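import Mathlib
import Summits.ValiantsHypothesis.ValiantsHypothesis.Theorems.FreeSubtorusOrbitDimensionBoundStubSignCountPrelim
import Summits.ValiantsHypothesis.ValiantsHypothesis.Theorems.RigidityForcesSymmetryRankRigidMinimalReprPathExpansion
import Summits.ValiantsHypothesis.ValiantsHypothesis.Theorems.RigidityForcesSymmetryRankRigidMinimalReprStubLevelBound
import Literature.Computability.AlgebraicComplexity.PermanentIrreducible
import Literature.Computability.AlgebraicComplexity.StandardFamilies

/-!
# `OrbitDimensionBound` (stmt-ValiantsHypothesis-16133), rung line `sign_covering` — stub `stub_signCount`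
# (the sign-graded covering count, stub 4 of 4)

The line `Cruxes/OrbitDimensionBound/Lines/sign_covering.lean` (route `FreeSubtorus`, rung `Torsion.SignShadow`) reduces
the covering bound for SIGN-equivariant affine determinantal representations of `per_n` to four registered stubs;
`stub_signDiagonalise` is landed (p598702).  This file proves the LOAD-BEARING one,

  `stub_signCount : Stmt.stub_signCount`  (vocabulary `SignVec`, `pair`, `signRel`, `varVec`, `IsSignGraded` UNFOLDED),

**Statement.**  `n ≥ 3`, `Λ : Fin r → ℤ^{[n] ⊔ [n]}`, sign group `S_Λ = {s ∈ 𝔽₂^{[n] ⊔ [n]} | Λ̄ s = 0}`, grades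
`α, β : [m] → 𝔽₂^{[n] ⊔ [n]}`; `B` an `m × m` matrix whose every entry is `C a₀ + Σ_p a_p X_p` with `a₀ ≠ 0 ⇒ β_i − α_j ⊥ S_Λ`
and `a_p ≠ 0 ⇒ β_i − α_j − v_p ⊥ S_Λ` (`v_p = e_{inl p₁} + e_{inr p₂}`), `det B = c · per_n`, `c ≠ 0`.  Then
`C(n, ⌊n/2⌋) ≤ m · 2^r`.

**Proof.**  (0) `⊥ S_Λ` means `∈ U := span_{𝔽₂} Λ̄` (double annihilator, Prelim `mem_span_of_forall_dotProduct_eq_zero`), so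
`B` is GRADED by the group `G = 𝔽₂^{[n] ⊔ [n]} ⧸ U`: constants only where `β̄_i = ᾱ_j`, `x_p` only where
`β̄_i = ᾱ_j + v̄_p`.  (1) Graded normal form (Prelim `classGraded_normalForm`: von zur Gathen regularity + graded Gaussian
elimination + partial permutation matrices): WLOG `B(0) = Λ_{i₀}` and `det B = c'·per_n`, `c' ≠ 0`, grades permuted.
(2) Path expansion in this FIXED gauge (tree `PathExpansion.neg_dotProduct_pow_mulVec_eq_of_constPart_eq_lamMatrix`,
Chatterjee–Kumar–Volk 2024 Thm. 13): `c'·per_n = −bᵀ D^{n−2} c` with `b, c, D` the explicit linear blocks of `B` around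
`i₀`.  (3) Potentials: `b_j` is `v̄`-weighted-homogeneous of weight `β̄_{i₀} − ᾱ_j` and `D_{jl}` of weight `ᾱ_j − ᾱ_l`
(the diagonal `1`s force `β̄_j = ᾱ_j` off `i₀`), so `g_l := (bᵀ D^{t−1})_l` (`t = ⌊n/2⌋`) is homogeneous of degree `t`
AND weighted-homogeneous of weight `β̄_{i₀} − ᾱ_l` (Prelim `isWeightedHomogeneous_vecMul_pow`).  (4) Cut:
`c'·per_n = −Σ_l g_l h_l`; the monomial `x_ρ = Π_i x_{ρ i, i}` of `per_n` has a nonzero coefficient, so for some `l`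
a divisor `Σ_{i ∈ I} e_{(ρ i, i)}` of it (`|I| = t`) occurs in `g_l`, whence `(1_{ρ I} ; 1_I) + U = β̄_{i₀} − ᾱ_l`.
(5) Count: `ρ ↦ (l, I, ρ I)` has fibres of size `≤ t!(n−t)!` (tree `card_perm_map_eq_le`), and for fixed `l`
the pairs `(I, J)` with `(1_J ; 1_I)` in ONE coset of `U` number `≤ |U| ≤ 2^r` (`(I, J) ↦ (1_J ; 1_I)` is injective);
so `n! ≤ t!(n−t)!·(m−1)·2^r`, i.e. `C(n, t) ≤ (m−1)·2^r ≤ m·2^r`.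

Sanity (`per ↦ det` must break the proof): it breaks at (1) — `det_n = det X` is a full-sign-group-equivariant
representation of size `n < C(n, ⌊n/2⌋)` (`n ≥ 5`) with `B(0) = 0`, not of corank one.

Helper mode (`--supports stmt-ValiantsHypothesis-16133 --as helper`): the item's registered skeleton is `affine_multiple`;
a crux-write holder closes skeleton stub 4 of `sign_covering` by `exact SignCovering.stub_signCount` (defeq-checked against a
verbatim copy of the line's §0–§1).  Honest framing: the rung line `sign_covering` still has `stub_perSummand`
(Krull–Schmidt) and `stub_signLinearise` (homomorphic lifts) OPEN; the crux `OrbitDimensionBound`, the route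
`FreeSubtorus` and VP ≠ VNP are OPEN and NOT moved by this file.

## References
* [LandsbergRessayre2017] J. M. Landsberg, N. Ressayre, *Permanent v. determinant: an exponential lower bound assuming
  symmetry and a potential path towards Valiant's conjecture*, Differential Geom. Appl. 55 (2017), §6, Question 2.2.
* [ChatterjeeKumarVolk2024] P. Chatterjee, M. Kumar, B. L. Volk, *Determinants vs. algebraic branching programs*,
  comput. complexity 33 (2024), Thm. 13.
* [Vonzurgathen1987] J. von zur Gathen, *Permanent and determinant*, Linear Algebra Appl. 96 (1987), Thm. 3.1.
-/

set_option linter.dupNamespace false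

namespace Summit.ValiantsHypothesis.ValiantsHypothesis.Theorems.FreeSubtorusOrbitDimensionBound.SignCovering

open Matrix MvPolynomial Finset
open Literature.Computability.AlgebraicComplexity LRPencil
open Summit.ValiantsHypothesis.ValiantsHypothesis.Theorems.RigidityForcesSymmetryRankRigidMinimalRepr
  (PathExpansion.neg_dotProduct_pow_mulVec_eq_of_constPart_eq_lamMatrix card_perm_map_eq_le)

noncomputable section

/-! ### §1 Affine entries given as `C a₀ + Σ_p a_p • X_p` -/

/-- Bookkeeping for an entry written as `C a₀ + Σ_p a_p • X_p`: it is affine, its constant term is `a₀` and the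
coefficient of `X_q` is `a_q`. [folklore] -/
theorem affine_entry_data {σ : Type*} [Fintype σ] [DecidableEq σ] (a₀ : ℂ) (a : σ → ℂ) :
    (C a₀ + ∑ p, a p • X p : MvPolynomial σ ℂ).totalDegree ≤ 1 ∧
    constantCoeff (C a₀ + ∑ p, a p • X p : MvPolynomial σ ℂ) = a₀ ∧
    ∀ q, coeff (Finsupp.single q 1) (C a₀ + ∑ p, a p • X p : MvPolynomial σ ℂ) = a q := by
  refine ⟨?_, ?_, fun q => ?_⟩
  · refine (totalDegree_add _ _).trans (max_le (by rw [totalDegree_C]; exact Nat.zero_le _) ?_)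
    refine totalDegree_finsetSum_le fun p _ => ?_
    exact (totalDegree_smul_le _ _).trans (by rw [totalDegree_X])
  · rw [map_add, constantCoeff_C, map_sum, Finset.sum_eq_zero, add_zero]
    intro p _
    rw [smul_eq_C_mul, map_mul, constantCoeff_X, mul_zero]
  · rw [coeff_add, coeff_C, if_neg (fun h => (Finsupp.single_ne_zero.mpr (one_ne_zero' ℕ)) h.symm), zero_add,
      coeff_sum]
    simp_rw [coeff_smul, coeff_X, smul_eq_mul]
    rw [Finset.sum_eq_single q, if_pos rfl, mul_one]
    · intro p _ hp
      rw [if_neg (fun h => hp (Finsupp.single_left_injective one_ne_zero h)), mul_zero]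
    · intro hq; exact absurd (Finset.mem_univ q) hq

/-! ### §2 The stub -/

/-- **Stub `stub_signCount` of the line `sign_covering`** (statement = the line's `Stmt.stub_signCount` with `SignVec`,
`pair`, `signRel`, `varVec`, `IsSignGraded` unfolded) — **the sign-graded covering count**: a sign-graded affine matrix
of size `m` with `det = c · per_n`, `c ≠ 0`, `n ≥ 3`, `Λ` with `r` generators, has `C(n, ⌊n/2⌋) ≤ m · 2^r`.  Proof: graded
normal form `B(0) = Λ_{i₀}` (regularity + graded elimination), path expansion `c'·per_n = −bᵀ D^{n−2} c` in that fixed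
gauge (CKV 2024 Thm. 13), potentials make `(bᵀ D^{t−1})_l` weighted-homogeneous for `𝔽₂^{2n} ⧸ span Λ̄`, the middle cut
serves every permutation monomial by a pair `(l, I)` whose character class is that of `l`, a coset of `span Λ̄` holds
`≤ 2^r` characters and a pair `(I, ρ I)` serves `t!(n−t)!` permutations.  (The admissibility hypothesis on `Λ` is not
used.) [cite: LandsbergRessayre2017, §6, Question 2.2] -/
theorem stub_signCount :
    ∀ (n m r : ℕ) (Λ : Fin r → (Fin n ⊕ Fin n) → ℤ) (α β : Fin m → (Fin n ⊕ Fin n) → ZMod 2)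
      (B : Matrix (Fin m) (Fin m) (MvPolynomial (Fin n × Fin n) ℂ)) (c : ℂ),
      3 ≤ n →
      (∀ i, (∑ k, Λ i (Sum.inl k)) = 0 ∧ (∑ l, Λ i (Sum.inr l)) = 0) →
      (∀ i j, ∃ (a₀ : ℂ) (a : Fin n × Fin n → ℂ),
        B i j = C a₀ + ∑ p, a p • X p ∧
        (a₀ ≠ 0 → ∀ s ∈ {s : (Fin n ⊕ Fin n) → ZMod 2 | ∀ i, (∑ x, ((Λ i x : ℤ) : ZMod 2) * s x) = 0},
          (∑ x, (β i - α j) x * s x) = 0) ∧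
        (∀ p, a p ≠ 0 → ∀ s ∈ {s : (Fin n ⊕ Fin n) → ZMod 2 | ∀ i, (∑ x, ((Λ i x : ℤ) : ZMod 2) * s x) = 0},
          (∑ x, (β i - α j - fun x => Sum.elim (fun k => if k = p.1 then (1 : ZMod 2) else 0)
            (fun l => if l = p.2 then (1 : ZMod 2) else 0) x) x * s x) = 0)) →
      c ≠ 0 → B.det = C c * perPoly (Fin n) ℂ →
      n.choose (n / 2) ≤ m * 2 ^ r := by
  intro n m r Λ α β B c hn _hΛ hgr hc hdet
  classical
  -- §0 the grading group `G = 𝔽₂^{[n] ⊔ [n]} ⧸ U`, `U = span Λ̄ ⊇ S_Λ^⊥`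
  set L : Fin r → (Fin n ⊕ Fin n) → ZMod 2 := fun i x => ((Λ i x : ℤ) : ZMod 2) with hL
  set U : Submodule (ZMod 2) ((Fin n ⊕ Fin n) → ZMod 2) := Submodule.span (ZMod 2) (Set.range L) with hU
  set vv : Fin n × Fin n → (Fin n ⊕ Fin n) → ZMod 2 := fun p x =>
    Sum.elim (fun k => if k = p.1 then (1 : ZMod 2) else 0) (fun l => if l = p.2 then (1 : ZMod 2) else 0) x with hvv
  set ω : Fin n × Fin n → ((Fin n ⊕ Fin n) → ZMod 2) ⧸ U := fun p => U.mkQ (vv p) with hω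
  have memU : ∀ w : (Fin n ⊕ Fin n) → ZMod 2,
      (∀ s ∈ {s : (Fin n ⊕ Fin n) → ZMod 2 | ∀ i, (∑ x, ((Λ i x : ℤ) : ZMod 2) * s x) = 0}, (∑ x, w x * s x) = 0) →
      w ∈ U := fun w hw =>
    mem_span_of_forall_dotProduct_eq_zero L w (fun s hs => hw s hs)
  -- §1 the entries: affine, with graded constants and variables
  have hdeg : ∀ i j, (B i j).totalDegree ≤ 1 := by
    intro i j
    obtain ⟨a₀, a, hB, -, -⟩ := hgr i j
    rw [hB]; exact (affine_entry_data a₀ a).1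
  have h0 : ∀ i j, constPart B i j ≠ 0 → U.mkQ (β i) = U.mkQ (α j) := by
    intro i j hij
    obtain ⟨a₀, a, hB, ha₀, -⟩ := hgr i j
    rw [constPart_apply, hB, (affine_entry_data a₀ a).2.1] at hij
    have hm := memU _ (ha₀ hij)
    rw [Submodule.mkQ_apply, Submodule.mkQ_apply, Submodule.Quotient.eq]
    exact hm
  have h1 : ∀ i j p, coeffMat B p i j ≠ 0 → U.mkQ (β i) = U.mkQ (α j) + ω p := by
    intro i j p hij
    obtain ⟨a₀, a, hB, -, ha⟩ := hgr i j
    rw [coeffMat_apply, hB, (affine_entry_data a₀ a).2.2 p] at hij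
    have hm : β i - α j - vv p ∈ U := memU _ (ha p hij)
    have h2 : U.mkQ (β i - α j - vv p) = 0 := by
      rw [Submodule.mkQ_apply, Submodule.Quotient.mk_eq_zero]; exact hm
    rw [map_sub, map_sub, sub_sub, sub_eq_zero] at h2
    rw [hω]; exact h2
  -- §2 the graded normal form `B(0) = Λ_{i₀}` (grades encoded in `ℤ` through a finite enumeration of `G`)
  obtain ⟨N, ⟨eG⟩⟩ := Finite.exists_equiv_fin (((Fin n ⊕ Fin n) → ZMod 2) ⧸ U)
  have henc : Function.Injective (fun g : ((Fin n ⊕ Fin n) → ZMod 2) ⧸ U => ((eG g : ℕ) : ℤ)) := by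
    intro g g' h
    simp only at h
    exact eG.injective (Fin.ext (by exact_mod_cast h))
  obtain ⟨B', rβ', rα', i₀, c', hc', hdeg', hdet', h0', h1', hlam⟩ :=
    classGraded_normalForm (fun g => ((eG g : ℕ) : ℤ)) henc hn B (fun i => U.mkQ (β i)) (fun j => U.mkQ (α j)) ω c
      hc hdeg hdet h0 h1
  -- §3 `m = m₁ + 1` and the path expansion in the fixed gauge
  obtain ⟨hm, -⟩ := rank_constPart_of_det_eq_C_mul_perPoly hn B c hc hdeg hdet
  obtain ⟨m₁, rfl⟩ : ∃ m₁, m = m₁ + 1 := ⟨m - 1, by omega⟩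
  have hper : (perPoly (Fin n) ℂ).IsHomogeneous n := by
    simpa using (perPoly_isHomogeneous : (perPoly (Fin n) ℂ).IsHomogeneous _)
  obtain ⟨hABP, -⟩ := PathExpansion.neg_dotProduct_pow_mulVec_eq_of_constPart_eq_lamMatrix (perPoly (Fin n) ℂ) n
    hper (by omega) B' hdeg' c' hdet' i₀ hlam
  set b : Fin m₁ → MvPolynomial (Fin n × Fin n) ℂ := fun j => homogeneousComponent 1 (B' i₀ (i₀.succAbove j))
    with hb
  set cv : Fin m₁ → MvPolynomial (Fin n × Fin n) ℂ := fun j => homogeneousComponent 1 (B' (i₀.succAbove j) i₀)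
    with hcv
  set D : Matrix (Fin m₁) (Fin m₁) (MvPolynomial (Fin n × Fin n) ℂ) :=
    Matrix.of fun j l => -homogeneousComponent 1 (B' (i₀.succAbove j) (i₀.succAbove l)) with hD
  have hbhom : ∀ j, (b j).IsHomogeneous 1 := fun j => homogeneousComponent_isHomogeneous 1 _
  have hDhom : ∀ j l, (D j l).IsHomogeneous 1 := fun j l => by
    rw [hD, Matrix.of_apply]; exact (homogeneousComponent_isHomogeneous 1 _).neg
  -- potentials: `θ = β̄'_{i₀}`, `a_j = ᾱ'_{i₀.succAbove j}`; the diagonal `1`s force `β̄' = ᾱ'` off `i₀`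
  set θ : ((Fin n ⊕ Fin n) → ZMod 2) ⧸ U := rβ' i₀ with hθ
  set a : Fin m₁ → ((Fin n ⊕ Fin n) → ZMod 2) ⧸ U := fun j => rα' (i₀.succAbove j) with ha
  have hdiag : ∀ j, rβ' (i₀.succAbove j) = rα' (i₀.succAbove j) := fun j =>
    h0' _ _ (by rw [hlam, lamMatrix_apply, if_pos rfl, if_neg (Fin.succAbove_ne i₀ j)]; exact one_ne_zero)
  have hbw : ∀ j, (b j).IsWeightedHomogeneous ω (θ - a j) := fun j =>
    isWeightedHomogeneous_homogeneousComponent_one ω _ _ fun p hp => by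
      have h := h1' i₀ (i₀.succAbove j) p (by rwa [coeffMat_apply])
      rw [hθ, ha, h]; abel
  have hDw : ∀ j l, (D j l).IsWeightedHomogeneous ω (a j - a l) := fun j l => by
    rw [hD, Matrix.of_apply]
    refine isWeightedHomogeneous_neg (isWeightedHomogeneous_homogeneousComponent_one ω _ _ fun p hp => ?_)
    have h := h1' (i₀.succAbove j) (i₀.succAbove l) p (by rwa [coeffMat_apply])
    rw [hdiag j] at h
    rw [ha]; dsimp only; rw [h]; abel
  -- §4 the cut at depth `t = ⌊n/2⌋`: `c'·per_n = −Σ_l g_l h_l`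
  set t : ℕ := n / 2 with ht
  have hsum : C c' * perPoly (Fin n) ℂ = -∑ l, (b ᵥ* D ^ (t - 1)) l * (D ^ (n - 1 - t) *ᵥ cv) l := by
    rw [← hABP, show n - 2 = (t - 1) + (n - 1 - t) by omega, pow_add, ← Matrix.mulVec_mulVec,
      Matrix.dotProduct_mulVec]
    rfl
  have hghom : ∀ l, ((b ᵥ* D ^ (t - 1)) l).IsHomogeneous t := fun l => by
    have := isHomogeneous_vecMul_pow hbhom hDhom (t - 1) l
    rwa [show t - 1 + 1 = t by omega] at this
  have hgw : ∀ l, ((b ᵥ* D ^ (t - 1)) l).IsWeightedHomogeneous ω (θ - a l) :=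
    isWeightedHomogeneous_vecMul_pow ω b D θ a hbw hDw (t - 1)
  -- §5 every permutation monomial is served by a pair `(l, I)` in the class of `l`
  have served : ∀ ρ : Equiv.Perm (Fin n), ∃ (l : Fin m₁) (I : Finset (Fin n)), I.card = t ∧
      U.mkQ (∑ i ∈ I, vv (ρ i, i)) = θ - a l := by
    intro ρ
    have hcoef : coeff (permMonomial ρ) (∑ l, (b ᵥ* D ^ (t - 1)) l * (D ^ (n - 1 - t) *ᵥ cv) l) ≠ 0 := by
      have e1 : ∑ l, (b ᵥ* D ^ (t - 1)) l * (D ^ (n - 1 - t) *ᵥ cv) l = -(C c' * perPoly (Fin n) ℂ) := by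
        rw [hsum, neg_neg]
      rw [e1, coeff_neg, coeff_C_mul, coeff_permMonomial_perPoly, mul_one, neg_ne_zero]
      exact hc'
    rw [coeff_sum] at hcoef
    obtain ⟨l, -, hl⟩ := Finset.exists_ne_zero_of_sum_ne_zero hcoef
    rw [coeff_mul] at hl
    obtain ⟨x, hx, hxne⟩ := Finset.exists_ne_zero_of_sum_ne_zero hl
    have hx1 : coeff x.1 ((b ᵥ* D ^ (t - 1)) l) ≠ 0 := left_ne_zero_of_mul hxne
    have hle : x.1 ≤ permMonomial ρ := by
      have h := Finset.HasAntidiagonal.mem_antidiagonal.1 hx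
      rw [← h]; exact le_self_add
    obtain ⟨I, hI⟩ := exists_eq_sum_single_of_le_permMonomial ρ x.1 hle
    have hdegI : Finsupp.weight (1 : Fin n × Fin n → ℕ) x.1 = t := hghom l hx1
    have hwI : Finsupp.weight ω x.1 = θ - a l := hgw l hx1
    refine ⟨l, I, ?_, ?_⟩
    · rw [hI, weight_sum_single] at hdegI
      simpa using hdegI
    · rw [hI, weight_sum_single] at hwI
      rw [map_sum]
      exact hwI
  -- §6 counting: `ρ ↦ (l, I, ρ I)`
  choose lρ Iρ hIcard hIcls using served
  set indv : Finset (Fin n) × Finset (Fin n) → (Fin n ⊕ Fin n) → ZMod 2 := fun IJ x =>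
    Sum.elim (fun k => if k ∈ IJ.2 then (1 : ZMod 2) else 0) (fun l => if l ∈ IJ.1 then (1 : ZMod 2) else 0) x
    with hindv
  have hind_eq : ∀ (ρ : Equiv.Perm (Fin n)) (I : Finset (Fin n)),
      ∑ i ∈ I, vv (ρ i, i) = indv (I, I.map ρ.toEmbedding) := by
    intro ρ I
    funext x
    rw [Finset.sum_apply]
    rcases x with k | l
    · have e1 : ∀ i, vv (ρ i, i) (Sum.inl k) = if k = ρ i then (1 : ZMod 2) else 0 := fun i => by
        simp only [hvv, Sum.elim_inl]
      simp_rw [e1]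
      have e2 : (∑ i ∈ I, if k = ρ i then (1 : ZMod 2) else 0) =
          ∑ y ∈ I.map ρ.toEmbedding, if k = y then (1 : ZMod 2) else 0 := by
        rw [Finset.sum_map]; rfl
      rw [e2, Finset.sum_ite_eq]
      simp only [hindv, Sum.elim_inl]
    · have e1 : ∀ i, vv (ρ i, i) (Sum.inr l) = if l = i then (1 : ZMod 2) else 0 := fun i => by
        simp only [hvv, Sum.elim_inr]
      simp_rw [e1]
      rw [Finset.sum_ite_eq]
      simp only [hindv, Sum.elim_inr]
  have hind_inj : Function.Injective indv := by
    intro p q hpq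
    have hx : ∀ x, indv p x = indv q x := fun x => congrFun hpq x
    refine Prod.ext (Finset.ext fun l => ?_) (Finset.ext fun k => ?_)
    · have h := hx (Sum.inr l)
      simp only [hindv, Sum.elim_inr] at h
      by_cases hp : l ∈ p.1 <;> by_cases hq : l ∈ q.1 <;> simp [hp, hq] at h ⊢
    · have h := hx (Sum.inl k)
      simp only [hindv, Sum.elim_inl] at h
      by_cases hp : k ∈ p.2 <;> by_cases hq : k ∈ q.2 <;> simp [hp, hq] at h ⊢
  set f : Equiv.Perm (Fin n) → Fin m₁ × (Finset (Fin n) × Finset (Fin n)) :=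
    fun ρ => (lρ ρ, (Iρ ρ, (Iρ ρ).map ρ.toEmbedding)) with hf
  set W : Finset (Fin m₁ × (Finset (Fin n) × Finset (Fin n))) :=
    univ.filter fun x => x.2.1.card = t ∧ U.mkQ (indv x.2) = θ - a x.1 with hW
  have hfW : ∀ ρ ∈ (univ : Finset (Equiv.Perm (Fin n))), f ρ ∈ W := fun ρ _ => by
    simp only [hW, hf, mem_filter, mem_univ, true_and]
    exact ⟨hIcard ρ, by rw [← hind_eq]; exact hIcls ρ⟩
  have hfib : ∀ x ∈ W, (univ.filter fun ρ => f ρ = x).card ≤ t.factorial * (n - t).factorial := by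
    rintro ⟨l, I, J⟩ hx
    have hI : I.card = t := (mem_filter.1 hx).2.1
    calc (univ.filter fun ρ => f ρ = (l, I, J)).card
        ≤ (univ.filter fun ρ : Equiv.Perm (Fin n) => I.map ρ.toEmbedding = J).card := by
          refine card_le_card fun ρ hρ => ?_
          simp only [mem_filter, mem_univ, true_and, hf, Prod.mk.injEq] at hρ ⊢
          obtain ⟨-, hI', hJ'⟩ := hρ
          rw [← hI']; exact hJ'
      _ ≤ t.factorial * (n - t).factorial := by
          rw [← hI]; exact card_perm_map_eq_le I J
  have hcount := card_le_mul_card_image_of_maps_to hfW _ hfib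
  rw [card_univ, Fintype.card_perm, Fintype.card_fin] at hcount
  -- `|W| ≤ m₁ · |U|`: the fibre of `W` over `l` is labelled injectively by characters in ONE coset of `U`
  have hfibre : ∀ l : Fin m₁, (W.filter fun x => x.1 = l).card ≤ Nat.card U := by
    intro l
    have hinj : Set.InjOn (fun x : Fin m₁ × (Finset (Fin n) × Finset (Fin n)) => indv x.2)
        ↑(W.filter fun x => x.1 = l) := by
      intro x hx y hy hxy
      have hx1 : x.1 = l := (mem_filter.1 (Finset.mem_coe.1 hx)).2
      have hy1 : y.1 = l := (mem_filter.1 (Finset.mem_coe.1 hy)).2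
      exact Prod.ext (hx1.trans hy1.symm) (hind_inj hxy)
    refine card_le_natCard_of_mkQ_eq U _ (fun x => indv x.2) hinj (θ - a l) fun x hx => ?_
    have hx' := (mem_filter.1 (mem_filter.1 hx).1).2.2
    rw [(mem_filter.1 hx).2] at hx'
    exact hx'
  have hWle : W.card ≤ m₁ * Nat.card U := by
    rw [Finset.card_eq_sum_card_fiberwise (f := Prod.fst) (s := W) (t := (univ : Finset (Fin m₁)))
      (fun _ _ => Finset.mem_coe.2 (mem_univ _))]
    calc ∑ l, (W.filter fun x => x.1 = l).card ≤ ∑ _l : Fin m₁, Nat.card U :=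
          Finset.sum_le_sum fun l _ => hfibre l
      _ = m₁ * Nat.card U := by rw [Finset.sum_const, card_univ, Fintype.card_fin, smul_eq_mul]
  have hU2 : Nat.card U ≤ 2 ^ r := natCard_span_le_two_pow L
  -- §7 arithmetic: `n! ≤ t!(n−t)!·|W|`, `|W| ≤ m₁·2^r`
  have hfact : n.choose t * (t.factorial * (n - t).factorial) = n.factorial := by
    rw [← mul_assoc, Nat.choose_mul_factorial_mul_factorial (by omega : t ≤ n)]
  have hpos : 0 < t.factorial * (n - t).factorial := Nat.mul_pos (Nat.factorial_pos _) (Nat.factorial_pos _)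
  have key : n.choose t ≤ W.card := by
    refine Nat.le_of_mul_le_mul_right ?_ hpos
    rw [hfact]
    calc n.factorial ≤ t.factorial * (n - t).factorial * W.card := hcount
      _ = W.card * (t.factorial * (n - t).factorial) := mul_comm _ _
  calc n.choose (n / 2) = n.choose t := rfl
    _ ≤ W.card := key
    _ ≤ m₁ * Nat.card U := hWle
    _ ≤ m₁ * 2 ^ r := Nat.mul_le_mul_left _ hU2
    _ ≤ (m₁ + 1) * 2 ^ r := Nat.mul_le_mul_right _ (Nat.le_succ _)

end

end Summit.ValiantsHypothesis.ValiantsHypothesis.Theorems.FreeSubtorusOrbitDimensionBound.SignCovering
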